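import Summits.HodgeConjecture.CorCM.HypDel.ExtAmbientReceptacle
import Literature.AlgebraicGeometry.ModuliOfAbelianVarieties.SiegelCanonicalModel
import Literature.AlgebraicGeometry.ShimuraVarieties.UnitaryAuxiliaryComplexStructure
import HarnessLib

/-!
# τ0-T3 v4 (A/2) — the Q-architecture VOCABULARY (`IsAuxScalars`, `IsProductLevel`, `PointFormulaN`, `ParamInjective`, `PointFormulaK`, `GaloisIntertwines`) and the stub statements `FrameExists`, `S2Inj` (tower form), `S2Pair`, `S2Imm` (+ `three_le_mul_succ`)

Cell `hodgecm-mathlib`, crux `HDel` (stmt-HodgeConjecture-24835), fan B / B-plan2 (T3 pen), KEY `t3-tau0-v4-qarch-port` (B-p19 g5).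
τ0 PORT of the v4 «Q-ARCHITECTURE» of the HDel crux workfile (draft `B-plan/specs/F1ExtHodgeType.v4-draft.B-plan2g4.lean` sha16 0f5fc804bbb4dcb3,
§8, re-cut 14:57Z with `S2Inj` in TOWER form; probe-e 472e67d5 kernel-green against the real (σ4)-D, sorries = the 7 stubs only): the receptacle
`AmbientReceptacleExists` (★ τ0-T3 F1 `CorCM/HypDel/ExtAmbientReceptacle.lean`) ⟸ seven registered stubs (S1 · frame · S2inj · S2pair · S2imm ·
Squot · S4) along Deligne's construction [Del71, §5; Del79, 2.3.10]: the receptacle is a FINITE QUOTIENT of a principal-level SIEGEL modular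
variety reached through the symplectic embedding of the auxiliary datum (★ (g-b) `auxComplexStructure`) at a PRODUCT level, followed by the
quotient by a finite group acting through integral Hecke operators of the Siegel ℚ-model (★ (σ4)-D `SiegelCanonicalModel`).  The vocabulary,
the stub statements and the head are relocated VERBATIM (token-identical; only namespace / opens / imports change) into importable modules in
TWO parts, so that the stub owners (B-p03 frame, A-p05 S2inj/S4, B-p05 S2imm, B-p02+B-p06 Squot, the (σ5) consumer for S2pair) conclude them
BY NAME and the workfile shrinks to «imports + 7 `stub_*` + `HDel_proof`»: PART A (`…QArchA.lean`: vocabulary incl. `GaloisIntertwines`,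
`FrameExists`, `three_le_mul_succ`, `S2Inj`, `S2Pair`, `S2Imm`) and PART B (`…QArchB.lean`: `SQuot`, `S4Push` and the HEAD `ambientReceptacle_of`).
Statements characterise construction data ONLY through POINT FORMULAS and `GaloisIntertwines`, never through chosen isomorphisms.
CIRCULARITY RULE (REF1): nothing here consumes `exists_recordSystem` / `canonicalModel_exists_printed` / any `(S : RecordSystem …)`.
NOTHING IS ASSERTED (defs of `Prop`s, one arithmetic lemma, one kernel-checked head; 0 `sorry`; no instance, no notation).

THIS FILE (A/2): draft :66–:121 (`section V4Vocabulary`) and :125–:213 (`FrameExists` :126, `three_le_mul_succ` :144, `S2Inj` :156, `S2Pair` :177, `S2Imm` :196),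
per the pen's 14:57:35Z cut «QArchA ports :76–:215».  Imports: ★ τ0-T3 F1, ★ (σ4)-D `SiegelCanonicalModel` (for `SiegelRationalModel` in
`GaloisIntertwines`), ★ (g-b) `UnitaryAuxiliaryComplexStructure`.
HC_CM is proved only modulo the 7 printed citations until rung 0 closes; nothing in this file is a proof of I-1′ or of `HDel`.
[cite: Deligne1971TravauxShimura, §5, Thm 4.21, 1.15, 5.4] [cite: Deligne1979ShimuraVarieties, Prop. 2.3.10] [cite: Milne2005ShimuraVarieties, §14 Prop 14.12, §12 (62)]
-/

noncomputable section

open Function MulAction Topology NumberField IsDedekindDomain CategoryTheory CategoryTheory.Limits Matrix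
  AlgebraicGeometry
open scoped Matrix ComplexOrder
open Literature.AlgebraicGeometry Literature.AlgebraicGeometry.Motives
open Literature.NumberTheory.Automorphic Literature.NumberTheory.Automorphic.UnitaryGroup
open Literature.NumberTheory.Automorphic.Liu2021.AppendixC (C5.OpenCompactSubgroup C5.SmallLevel)
open Literature.Geometry.ComplexHyperbolic Literature.Geometry.ComplexHyperbolic.BallModel
open Literature.AlgebraicGeometry.ShimuraVarieties Literature.AlgebraicGeometry.ShimuraVarieties.UnitaryCanonicalModel
open Literature.AlgebraicGeometry.ShimuraVarieties.UnitaryCanonicalModel.Aux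
open Literature.AlgebraicGeometry.ModuliOfAbelianVarieties
open Literature.NumberTheory.ComplexMultiplication (traceField reflexNormFiniteIdele)
open Literature.NumberTheory.AdelicBaseChange (finiteIdeleRelNorm)
open Summit.HodgeConjecture.CorCM.HypDel.ExtReceptacle (ReciprocityThrough AmbientReceptacle AmbientReceptacleExists)

namespace Summit.HodgeConjecture.CorCM.HypDel.ExtReceptacle.QArch

section V4Vocabulary

variable {L : Type} [Field L] [NumberField L] [IsCMField L]
variable {H : Matrix (Fin 3) (Fin 3) L} {τ : L →+* ℂ} {T : GL (Fin 3) ℂ}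
  {hT : formCongr (starRingEnd ℂ) T (H.map τ) = BallModel.J}
  {K₀ : C5.OpenCompactSubgroup ↥(finAdelic (↥(maximalRealSubfield L)) L (IsCMField.complexConj L) 3 H)}
variable (M : Type) [Field M] [NumberField M] [IsCMField M] {j : L →+* M} {ξ₀ ξ : M} {g : ℕ} {δ : Fin g → ℕ}

/-- **Sign / adaptedness package of the auxiliary scalars `ξ₀, ξ`** (module docstring of `UnitaryAuxiliaryTorusDatumExt` :28–36): both totally
imaginary, with `Im ρ(ξ₀) < 0` and `Im ρ(ξ) < 0` for every `ρ ∈ Φ` — the hypotheses under which `h_x · h_Φ` is polarised by `ψ = auxForm M j H ξ₀ ξ`. -/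
def IsAuxScalars (Φ : CMType M) (ξ₀ ξ : M) : Prop :=
  IsCMField.complexConj M ξ₀ = -ξ₀ ∧ IsCMField.complexConj M ξ = -ξ ∧ ∀ ρ : M →+* ℂ, ρ ∈ Φ.1 → (ρ ξ₀).im < 0 ∧ (ρ ξ).im < 0

/-- **PRODUCT LEVEL**: `auxLevel F N = K_V ×ˢ L_V` (Q6b (iii)). -/
def IsProductLevel (F : SymplecticFrame M j H ξ₀ ξ g δ) (N : ℕ)
    (KV : Subgroup ↥(finAdelic (↥(maximalRealSubfield L)) L (IsCMField.complexConj L) 3 H)) (LV : Subgroup ↥(torusFinAdelic M)) : Prop :=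
  auxLevel F N = KV.prod LV

/-- **POINT FORMULA at the product level** `K̃(N) = K_V × L_V`: the morphism `ι'` sends `([x, aK_V], p)`, `p = [t]`, to the Siegel point
`[J_x, ũ_β(a,t)·K_δ(N)]`. -/
def PointFormulaN (Sc : ComplexRecordSystem L H τ T hT K₀) (Φ : CMType M) (F : SymplecticFrame M j H ξ₀ ξ g δ)
    (hJ : ∀ x : Ball, auxComplexStructure F τ Φ T x ∈ C0pm δ) (LV : C5.OpenCompactSubgroup ↥(torusFinAdelic M)) (KV : C5.SmallLevel K₀)
    (Sg : SiegelComplexRecordSystem g δ) (KN : SiegelLevel δ) (ι' : (complexSystemExt M Sc LV).obj KV ⟶ Sg.Mc.obj KN) : Prop :=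
  ∀ (p : classGroup M LV) (x : Ball) (a : finAdelic (↥(maximalRealSubfield L)) L (IsCMField.complexConj L) 3 H)
    (t : ↥(torusFinAdelic M)), classOf M LV t = p →
    AlgPoints.map ι' (summandPointExt M Sc LV KV p x a) =
      (Sg.pts KN).symm (SiegelShimuraSet.mk δ KN.1 ⟨auxComplexStructure F τ Φ T x, hJ x⟩ (auxToGspFin F (a, t)))

/-- **PARAMETRISED INJECTIVITY at the product level** (S2inj's conclusion): equal Siegel images ⇒ equal unitary points and equal classes. -/
def ParamInjective (τ : L →+* ℂ) (T : GL (Fin 3) ℂ) (hT : formCongr (starRingEnd ℂ) T (H.map τ) = BallModel.J) (Φ : CMType M)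
    (F : SymplecticFrame M j H ξ₀ ξ g δ) (hJ : ∀ x : Ball, auxComplexStructure F τ Φ T x ∈ C0pm δ) (N : ℕ)
    (KV : Subgroup ↥(finAdelic (↥(maximalRealSubfield L)) L (IsCMField.complexConj L) 3 H)) (LV : C5.OpenCompactSubgroup ↥(torusFinAdelic M)) :
    Prop :=
  ∀ (x x' : Ball) (a a' : finAdelic (↥(maximalRealSubfield L)) L (IsCMField.complexConj L) 3 H) (t t' : ↥(torusFinAdelic M)),
    SiegelShimuraSet.mk δ (principalLevelSubgroup δ N) ⟨auxComplexStructure F τ Φ T x, hJ x⟩ (auxToGspFin F (a, t)) =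
        SiegelShimuraSet.mk δ (principalLevelSubgroup δ N) ⟨auxComplexStructure F τ Φ T x', hJ x'⟩ (auxToGspFin F (a', t')) →
      ShimuraSet.mk L H τ T hT KV x a = ShimuraSet.mk L H τ T hT KV x' a' ∧ classOf M LV t = classOf M LV t'

/-- **POINT FORMULA at level `K × L₀` through a points map `Ψ` of the Siegel receptacle.** -/
def PointFormulaK (Sc : ComplexRecordSystem L H τ T hT K₀) (Φ : CMType M) (F : SymplecticFrame M j H ξ₀ ξ g δ)
    (hJ : ∀ x : Ball, auxComplexStructure F τ Φ T x ∈ C0pm δ) (L₀ : C5.OpenCompactSubgroup ↥(torusFinAdelic M)) (K : C5.SmallLevel K₀) (Sg : SiegelComplexRecordSystem g δ) (KN : SiegelLevel δ)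
    {E : IntermediateField ℚ ℂ} (A : SchemeOver ↥E) (ι : (complexSystemExt M Sc L₀).obj K ⟶ (Motives.baseChange ↥E ℂ).obj A)
    (Ψ : ComplexPoints (Sg.Mc.obj KN) → ComplexPoints ((Motives.baseChange ↥E ℂ).obj A)) : Prop :=
  ∀ (p : classGroup M L₀) (x : Ball) (a : finAdelic (↥(maximalRealSubfield L)) L (IsCMField.complexConj L) 3 H)
    (t : ↥(torusFinAdelic M)), classOf M L₀ t = p →
    AlgPoints.map ι (summandPointExt M Sc L₀ K p x a) =
      Ψ ((Sg.pts KN).symm (SiegelShimuraSet.mk δ KN.1 ⟨auxComplexStructure F τ Φ T x, hJ x⟩ (auxToGspFin F (a, t))))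

/-- **`Ψ` INTERTWINES the Galois actions**: `Aut(ℂ/E)` on the `ℚ`-structure points of `Sg.Mc_{K_N}` (through `R.ptQ`) and on `A`'s `E`-structure. -/
def GaloisIntertwines {Sg : SiegelComplexRecordSystem g δ} (R : SiegelRationalModel g δ Sg) (KN : SiegelLevel δ)
    {E : IntermediateField ℚ ℂ} (A : SchemeOver ↥E) (Ψ : ComplexPoints (Sg.Mc.obj KN) → ComplexPoints ((Motives.baseChange ↥E ℂ).obj A)) :
    Prop :=
  ∀ (σ : ℂ ≃ₐ[↥E] ℂ) (P P' : ComplexPoints (Sg.Mc.obj KN)),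
    R.ptQ KN P' = (σ.restrictScalars ℚ) • R.ptQ KN P → σ • (pointsOfForm A).symm (Ψ P) = (pointsOfForm A).symm (Ψ P')

end V4Vocabulary

/-! ### The stub statements as CLOSED Props (binder block of `AmbientReceptacleExists` + the Q-architecture data): frame · S2inj (tower form) · S2pair · S2imm -/

/-- **FRAME (Q6a+Q6b+ξ-choice; owner B-p03).** -/
def FrameExists : Prop :=
  ∀ (L : Type) [Field L] [NumberField L] [IsCMField L] (H : Matrix (Fin 3) (Fin 3) L) (τ : L →+* ℂ),
    (∀ τ' : L →+* ℂ, InfinitePlace.mk τ' ≠ InfinitePlace.mk τ → (H.map τ').PosDef) →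
    (∀ v : Fin 3 → L, ShimuraVarieties.hermForm (cmConjRingHom L) H v v = 0 → v = 0) →
    ∀ K₀ : C5.OpenCompactSubgroup ↥(finAdelic (↥(maximalRealSubfield L)) L (IsCMField.complexConj L) 3 H),
        ∀ (M : Type) [Field M] [NumberField M] [IsCMField M] (j : L →+* M) (Φ : CMType M), IsExtAdapted τ j Φ →
            ∀ (L₀ : C5.OpenCompactSubgroup ↥(torusFinAdelic M)) (K : C5.SmallLevel K₀),
              ∃ (ξ₀ ξ : M) (g : ℕ) (δ : Fin g → ℕ) (F : SymplecticFrame M j H ξ₀ ξ g δ) (N₁ : ℕ),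
                IsAuxScalars M Φ ξ₀ ξ ∧ 0 < g ∧ IsPolarizationType δ ∧
                  (∀ T : GL (Fin 3) ℂ, formCongr (starRingEnd ℂ) T (H.map τ) = BallModel.J →
                    ∀ x : Ball, auxComplexStructure F τ Φ T x ∈ C0pm δ) ∧ 0 < N₁ ∧ K.1.1.prod L₀.1 ≤ auxLevel F 1 ∧
                  ∀ N : ℕ, N₁ ∣ N →
                    auxLevel F N ≤ K.1.1.prod L₀.1 ∧
                      (∀ x ∈ K.1.1.prod L₀.1, ∀ y ∈ auxLevel F N, x⁻¹ * y * x ∈ auxLevel F N) ∧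
                        ∃ (KV : C5.SmallLevel K₀) (LV : C5.OpenCompactSubgroup ↥(torusFinAdelic M)),
                          KV ≤ K ∧ LV ≤ L₀ ∧ IsProductLevel M F N KV.1.1 LV.1

/-- Level arithmetic for the injectivity tower: `3 ≤ N' * (m + 1)` from `3 ≤ N'`. -/
theorem three_le_mul_succ {N' : ℕ} (hN' : 3 ≤ N') (m : ℕ) : 3 ≤ N' * (m + 1) :=
  hN'.trans (Nat.le_mul_of_pos_right _ m.succ_pos)

/-- **S2inj — TOWER FORM (owner A-p05; reshape adopted 2026-08-28T14:5xZ).** Given the models, a tower of PRODUCT source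
levels `K̃(N'(m+1)) = KV m × LV m` (`m : ℕ`) and morphisms `ι m` into the Siegel levels `K_δ(N'(m+1))` satisfying the point
formula at every level, SOME level of the tower is point-injective. Proof plan (0 facts): model-free injectivity against the
whole tower (`S2InjCore`, Literature theorem: finite transporter + ★ `CompactMulInterAntitone` + rational points + (g-b′)
equivariance) ⇒ `⋂ₘ Rₘ = Δ` for the coincidence loci `Rₘ ⊆ T₀ × T₀` (closed: PROPER projections of a closed fibre product;
decreasing along divisibility) ⇒ stationarity (★ Q2 `exists_forall_le_map_eq_iff`, noetherian `T₀ × T₀`) ⇒ lift along the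
level torsor (★ Q4 `Aux.complexSystemExt_isLevelQuotient`) + freeness (★ Q3 `mem_principalLevelSubgroup_of_mk_mul_eq_mk`,
`N'(m+1) ≥ 3`) + `IsProductLevel`. (Deligne 1971, 1.15.3 — the noetherian argument lives on the varieties; the model-free
uniform statement would need reduction theory, which is why the models are binders here.) -/
def S2Inj : Prop :=
  ∀ (L : Type) [Field L] [NumberField L] [IsCMField L] (H : Matrix (Fin 3) (Fin 3) L) (τ : L →+* ℂ)
    (T : GL (Fin 3) ℂ) (hT : formCongr (starRingEnd ℂ) T (H.map τ) = BallModel.J),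
    (∀ τ' : L →+* ℂ, InfinitePlace.mk τ' ≠ InfinitePlace.mk τ → (H.map τ').PosDef) →
    (∀ v : Fin 3 → L, ShimuraVarieties.hermForm (cmConjRingHom L) H v v = 0 → v = 0) →
    ∀ K₀ : C5.OpenCompactSubgroup ↥(finAdelic (↥(maximalRealSubfield L)) L (IsCMField.complexConj L) 3 H),
      (∀ g : finAdelic (↥(maximalRealSubfield L)) L (IsCMField.complexConj L) 3 H,
        ∀ γ ∈ arithmeticLevel (↥(maximalRealSubfield L)) L (IsCMField.complexConj L) 3 H
          (K₀.1.map (MulAut.conj g).toMonoidHom), IsOfFinOrder γ → γ = 1) →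
        ∀ (Sc : ComplexRecordSystem L H τ T hT K₀) (M : Type) [Field M] [NumberField M] [IsCMField M] (j : L →+* M)
          (Φ : CMType M), IsExtAdapted τ j Φ →
          ∀ (ξ₀ ξ : M) (g : ℕ) (δ : Fin g → ℕ) (F : SymplecticFrame M j H ξ₀ ξ g δ),
            IsAuxScalars M Φ ξ₀ ξ → 0 < g → IsPolarizationType δ → ∀ (hJ : ∀ x : Ball, auxComplexStructure F τ Φ T x ∈ C0pm δ),
            ∀ (Sg : SiegelComplexRecordSystem g δ) (N' : ℕ) (hN' : 3 ≤ N')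
              (KV : ℕ → C5.SmallLevel K₀) (LV : ℕ → C5.OpenCompactSubgroup ↥(torusFinAdelic M)),
              (∀ m : ℕ, IsProductLevel M F (N' * (m + 1)) (KV m).1.1 (LV m).1) →
              ∀ ι : ∀ m : ℕ, (complexSystemExt M Sc (LV m)).obj (KV m) ⟶ Sg.Mc.obj (SiegelLevel.ofNat δ (N' * (m + 1)) (three_le_mul_succ hN' m)),
                (∀ m : ℕ, PointFormulaN M Sc Φ F hJ (LV m) (KV m) Sg (SiegelLevel.ofNat δ (N' * (m + 1)) (three_le_mul_succ hN' m)) (ι m)) →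
                ∃ m₀ : ℕ, ParamInjective M τ T hT Φ F hJ (N' * (m₀ + 1)) (KV m₀).1.1 (LV m₀)

/-- **S2pair (parked; owner TBD).** -/
def S2Pair : Prop :=
  ∀ (L : Type) [Field L] [NumberField L] [IsCMField L] (H : Matrix (Fin 3) (Fin 3) L) (τ : L →+* ℂ)
    (T : GL (Fin 3) ℂ) (hT : formCongr (starRingEnd ℂ) T (H.map τ) = BallModel.J),
    (∀ τ' : L →+* ℂ, InfinitePlace.mk τ' ≠ InfinitePlace.mk τ → (H.map τ').PosDef) →
    (∀ v : Fin 3 → L, ShimuraVarieties.hermForm (cmConjRingHom L) H v v = 0 → v = 0) →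
    ∀ K₀ : C5.OpenCompactSubgroup ↥(finAdelic (↥(maximalRealSubfield L)) L (IsCMField.complexConj L) 3 H),
      (∀ g : finAdelic (↥(maximalRealSubfield L)) L (IsCMField.complexConj L) 3 H,
        ∀ γ ∈ arithmeticLevel (↥(maximalRealSubfield L)) L (IsCMField.complexConj L) 3 H
          (K₀.1.map (MulAut.conj g).toMonoidHom), IsOfFinOrder γ → γ = 1) →
        ∀ (Sc : ComplexRecordSystem L H τ T hT K₀) (M : Type) [Field M] [NumberField M] [IsCMField M] (j : L →+* M)
          (Φ : CMType M), IsExtAdapted τ j Φ →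
          ∀ (ξ₀ ξ : M) (g : ℕ) (δ : Fin g → ℕ) (F : SymplecticFrame M j H ξ₀ ξ g δ),
            IsAuxScalars M Φ ξ₀ ξ → 0 < g → IsPolarizationType δ → ∀ (hJ : ∀ x : Ball, auxComplexStructure F τ Φ T x ∈ C0pm δ),
            ∀ (Sg : SiegelComplexRecordSystem g δ) (N : ℕ) (hN : 3 ≤ N)
              (KV : C5.SmallLevel K₀) (LV : C5.OpenCompactSubgroup ↥(torusFinAdelic M)), IsProductLevel M F N KV.1.1 LV.1 →
              ∃ ι' : (complexSystemExt M Sc LV).obj KV ⟶ Sg.Mc.obj (SiegelLevel.ofNat δ N hN),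
                PointFormulaN M Sc Φ F hJ LV KV Sg (SiegelLevel.ofNat δ N hN) ι'

/-- **S2imm (owner B-p05).** -/
def S2Imm : Prop :=
  ∀ (L : Type) [Field L] [NumberField L] [IsCMField L] (H : Matrix (Fin 3) (Fin 3) L) (τ : L →+* ℂ)
    (T : GL (Fin 3) ℂ) (hT : formCongr (starRingEnd ℂ) T (H.map τ) = BallModel.J),
    (∀ τ' : L →+* ℂ, InfinitePlace.mk τ' ≠ InfinitePlace.mk τ → (H.map τ').PosDef) →
    (∀ v : Fin 3 → L, ShimuraVarieties.hermForm (cmConjRingHom L) H v v = 0 → v = 0) →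
    ∀ K₀ : C5.OpenCompactSubgroup ↥(finAdelic (↥(maximalRealSubfield L)) L (IsCMField.complexConj L) 3 H),
      (∀ g : finAdelic (↥(maximalRealSubfield L)) L (IsCMField.complexConj L) 3 H,
        ∀ γ ∈ arithmeticLevel (↥(maximalRealSubfield L)) L (IsCMField.complexConj L) 3 H
          (K₀.1.map (MulAut.conj g).toMonoidHom), IsOfFinOrder γ → γ = 1) →
        ∀ (Sc : ComplexRecordSystem L H τ T hT K₀) (M : Type) [Field M] [NumberField M] [IsCMField M] (j : L →+* M)
          (Φ : CMType M), IsExtAdapted τ j Φ →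
          ∀ (ξ₀ ξ : M) (g : ℕ) (δ : Fin g → ℕ) (F : SymplecticFrame M j H ξ₀ ξ g δ),
            IsAuxScalars M Φ ξ₀ ξ → 0 < g → IsPolarizationType δ → ∀ (hJ : ∀ x : Ball, auxComplexStructure F τ Φ T x ∈ C0pm δ),
            ∀ (Sg : SiegelComplexRecordSystem g δ) (N : ℕ) (hN : 3 ≤ N)
              (KV : C5.SmallLevel K₀) (LV : C5.OpenCompactSubgroup ↥(torusFinAdelic M)), IsProductLevel M F N KV.1.1 LV.1 →
              ∀ ι' : (complexSystemExt M Sc LV).obj KV ⟶ Sg.Mc.obj (SiegelLevel.ofNat δ N hN),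
                PointFormulaN M Sc Φ F hJ LV KV Sg (SiegelLevel.ofNat δ N hN) ι' →
                ParamInjective M τ T hT Φ F hJ N KV.1.1 LV → IsClosedImmersion ι'.left

end Summit.HodgeConjecture.CorCM.HypDel.ExtReceptacle.QArch

end
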